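import Mathlib.Probability.ProbabilityMassFunction.Constructions
import Mathlib.Probability.Moments.Variance
import Mathlib.Probability.Independence.Basic
import HarnessLib

/-!
# Majority vote over independent trials with arbitrary weights (weak law, Chebyshev form)

Topic `Literature/Computability/Complexity`; companion of `MajorityVote.lean` (which treats *uniform*
trials by counting). Here one trial has finitely many outcomes `a : α` with arbitrary probability
weights `w a ≥ 0`, `∑ w = 1` — the shape in which majority-vote amplification is applied to the Born
weights of a quantum register (Bennett–Bernstein–Brassard–Vazirani 1997, proof of Thm. 4.13: "the
probability of seeing `|x_{i_1}⟩ ⋯ |x_{i_k}⟩` such that the majority have the correct answer is the sum of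
`|α_{i_1}|² ⋯ |α_{i_k}|²` such that the majority of `i_1, …, i_k` lie in `A`. But this is just like taking
the majority of `k` independent coin flips each with probability at least `2/3` of heads").

**Result** (`sum_majority_fail_mul_le`, `sum_majority_fail_le`): if the good outcomes carry weight
`≥ 1/2 + η` (`η > 0`), then the total product weight `∑_ω ∏ᵢ w (ω i)` of the outcome sequences
`ω : Fin m → α` of `m ≥ 1` trials in which the good trials are *not* a strict majority
(`2 · #{i | good (ω i)} ≤ m`) is at most `1/(4 m η²)` — Kranakis's Weak Law of Large Numbers
(Bernoulli case, Chebyshev: mean `≥ m(1/2 + η)`, variance `≤ m/4`).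

Proof: as in `MajorityVote.lean`, Mathlib's Chebyshev inequality
`ProbabilityTheory.meas_ge_le_variance_div_sq` for the number of good trials under the product
(`MeasureTheory.Measure.pi`) of the one-trial measure `PMF.toMeasure` of the weights, with
`ProbabilityTheory.variance_sum_pi` and the Bhatia–Davis bound `variance_le_sub_mul_sub`; the product
measure of a finite set of sequences is read off `Measure.pi_singleton`. The finite outcome type carries
the discrete measurable structure `⊤` inside the proof; the statements are about finite sums only.

## References

* C. H. Bennett, E. Bernstein, G. Brassard, U. Vazirani, *Strengths and weaknesses of quantum
  computing*, SIAM J. Comput. 26 (1997) 1510–1523, Thm. 4.13 (proof) [BennettBernsteinBrassardVazirani1997].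
* E. Kranakis, *Primality and Cryptography*, Wiley–Teubner 1986, §3.5, Lemma 3.1 (Chebyshev),
  Thm. 3.5 (Weak Law of Large Numbers, `≤ 1/(4nε²)`) [Kranakis1986].
* Mathlib: `ProbabilityTheory.meas_ge_le_variance_div_sq`, `ProbabilityTheory.variance_sum_pi`,
  `MeasureTheory.Measure.pi_singleton`, `PMF.toMeasure`.
-/

noncomputable section

namespace Literature.Computability.Complexity

open _root_.MeasureTheory _root_.ProbabilityTheory Finset

/-- **Weak law of large numbers for a weighted majority vote (Chebyshev form).** Let `w` be
probability weights on a finite outcome type `α` (`w ≥ 0`, `∑ w = 1`) under which the good outcomes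
have weight at least `1/2 + η` (`η > 0`). Then the product weight of the sequences `ω : Fin m → α` of
`m ≥ 1` trials without a strict majority of good trials, times `4 m η²`, is at most `1`.
(Chebyshev: the number of good trials has mean `≥ m(1/2 + η)` and variance `≤ m/4`.)
[Kranakis 1986, Thm. 3.5; Bennett–Bernstein–Brassard–Vazirani 1997, Thm. 4.13 (proof)]
[cite: Kranakis1986, Thm. 3.5] -/
theorem sum_majority_fail_mul_le {α : Type*} [Fintype α] (w : α → ℝ) (hw : ∀ a, 0 ≤ w a)
    (hw1 : ∑ a, w a = 1) (good : α → Prop) [DecidablePred good] {m : ℕ} (hm : 0 < m) {η : ℝ}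
    (hη : 0 < η) (hgood : 1 / 2 + η ≤ ∑ a ∈ univ.filter good, w a) :
    (∑ ω ∈ univ.filter (fun ω : Fin m → α => 2 * (univ.filter fun i => good (ω i)).card ≤ m),
        ∏ i, w (ω i)) * (4 * m * η ^ 2) ≤ 1 := by
  classical
  letI : MeasurableSpace α := ⊤
  haveI : MeasurableSingletonClass α := ⟨fun _ => MeasurableSpace.measurableSet_top⟩
  -- one trial: the measure with the weights `w`, and the indicator `X` of a good outcome
  have hsum : ∑ a, ENNReal.ofReal (w a) = 1 := by
    rw [← ENNReal.ofReal_sum_of_nonneg (fun a _ => hw a), hw1, ENNReal.ofReal_one]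
  set p : PMF α := PMF.ofFintype (fun a => ENNReal.ofReal (w a)) hsum with hp
  set μ : Measure α := p.toMeasure with hμ
  have hμa : ∀ a : α, μ {a} = ENNReal.ofReal (w a) := fun a => by
    rw [hμ, p.toMeasure_apply_singleton a (measurableSet_singleton a), hp, PMF.ofFintype_apply]
  set X : α → ℝ := fun a => if good a then 1 else 0 with hX
  have hXmeas : Measurable X := measurable_of_finite X
  have hXbdd : ∀ᵐ a ∂μ, X a ∈ Set.Icc (0 : ℝ) 1 :=
    ae_of_all _ fun a => by simp only [hX]; split_ifs <;> simp
  have hXLp : MemLp X 2 μ := memLp_of_bounded hXbdd hXmeas.aestronglyMeasurable 2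
  -- its mean is the good weight `≥ 1/2 + η`
  have hmean : (1 / 2 + η : ℝ) ≤ μ[X] := by
    rw [integral_fintype (MemLp.integrable (by norm_num) hXLp)]
    have hsing : ∀ a : α, μ.real {a} = w a := fun a => by
      rw [measureReal_def, hμa, ENNReal.toReal_ofReal (hw a)]
    simp only [hsing, smul_eq_mul]
    have e : ∑ a : α, w a * X a = ∑ a ∈ univ.filter good, w a := by
      rw [Finset.sum_filter]
      exact Finset.sum_congr rfl fun a _ => by simp only [hX]; split_ifs <;> simp
    rw [e]
    exact hgood
  -- its variance is at most `1/4`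
  have hvar : Var[X; μ] ≤ 1 / 4 := by
    have h := variance_le_sub_mul_sub hXbdd hXmeas.aemeasurable
    nlinarith [h, sq_nonneg (μ[X] - 1 / 2)]
  -- `m` independent trials: the product measure, and the number `S` of good trials
  set P : Measure (Fin m → α) := Measure.pi fun _ : Fin m => μ with hP
  set S : (Fin m → α) → ℝ := ∑ i : Fin m, fun ω => X (ω i) with hS
  have hSLp : MemLp S 2 P := by
    refine memLp_finsetSum' _ fun i _ => ?_
    exact hXLp.comp_measurePreserving (measurePreserving_eval (fun _ : Fin m => μ) i)
  have hSvar : Var[S; P] ≤ m / 4 := by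
    rw [hS, hP, variance_sum_pi fun _ => hXLp]
    calc ∑ _i : Fin m, Var[X; μ] ≤ ∑ _i : Fin m, (1 / 4 : ℝ) := Finset.sum_le_sum fun i _ => hvar
      _ = m / 4 := by
          simp only [Finset.sum_const, Finset.card_univ, Fintype.card_fin]; ring
  have hSmean : (m : ℝ) * (1 / 2 + η) ≤ P[S] := by
    have hint : ∀ i : Fin m, ∫ ω, X (ω i) ∂P = μ[X] := fun i => by
      have hmp := measurePreserving_eval (fun _ : Fin m => μ) i
      rw [← hmp.map_eq, integral_map (measurable_pi_apply i).aemeasurable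
        hXmeas.aestronglyMeasurable]
    have : P[S] = ∑ i : Fin m, ∫ ω, X (ω i) ∂P := by
      rw [hS, ← integral_finsetSum _ fun i _ => ?_]
      · simp only [Finset.sum_apply]
      · exact MemLp.integrable (by norm_num)
          (hXLp.comp_measurePreserving (measurePreserving_eval (fun _ : Fin m => μ) i))
    rw [this]
    simp only [hint, Finset.sum_const, Finset.card_univ, Fintype.card_fin, nsmul_eq_mul]
    exact mul_le_mul_of_nonneg_left hmean (by positivity)
  -- the failure event lies inside the Chebyshev tail `{m η ≤ |S - E S|}`
  set B : Finset (Fin m → α) :=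
    univ.filter fun ω : Fin m → α => 2 * (univ.filter fun i => good (ω i)).card ≤ m with hB
  have hSval : ∀ ω, S ω = ((univ.filter fun i => good (ω i)).card : ℝ) := fun ω => by
    rw [hS, Finset.natCast_card_filter, Finset.sum_apply]
  have hsub : (B : Set (Fin m → α)) ⊆ {ω | (m : ℝ) * η ≤ |S ω - P[S]|} := by
    intro ω hω
    rw [Finset.mem_coe, hB, Finset.mem_filter] at hω
    have h2 : 2 * ((univ.filter fun i => good (ω i)).card : ℝ) ≤ m := by exact_mod_cast hω.2
    have hmη : (0 : ℝ) ≤ m * η := by positivity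
    rw [Set.mem_setOf_eq, hSval ω, abs_sub_comm, abs_of_nonneg (by linarith)]
    linarith
  have hcheb := meas_ge_le_variance_div_sq hSLp (c := (m : ℝ) * η) (by positivity)
  have hPB : P B ≤ ENNReal.ofReal (1 / (4 * m * η ^ 2)) := by
    refine ((measure_mono hsub).trans hcheb).trans (ENNReal.ofReal_le_ofReal ?_)
    rw [div_le_div_iff₀ (by positivity) (by positivity)]
    have hm' : (1 : ℝ) ≤ m := by exact_mod_cast hm
    nlinarith [hSvar, sq_nonneg η, mul_pos (show (0:ℝ) < m by positivity) (sq_pos_of_pos hη)]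
  -- read the product measure of `B` as the product weight
  have hPB' : P B = ENNReal.ofReal (∑ ω ∈ B, ∏ i, w (ω i)) := by
    rw [← sum_measure_singleton, ENNReal.ofReal_sum_of_nonneg
      (fun ω _ => Finset.prod_nonneg fun i _ => hw (ω i))]
    refine Finset.sum_congr rfl fun ω _ => ?_
    rw [hP, Measure.pi_singleton, ENNReal.ofReal_prod_of_nonneg (fun i _ => hw (ω i))]
    exact Finset.prod_congr rfl fun i _ => hμa (ω i)
  rw [hPB'] at hPB
  have hnn : 0 ≤ ∑ ω ∈ B, ∏ i, w (ω i) :=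
    Finset.sum_nonneg fun ω _ => Finset.prod_nonneg fun i _ => hw (ω i)
  have hreal : ∑ ω ∈ B, ∏ i, w (ω i) ≤ 1 / (4 * m * η ^ 2) :=
    (ENNReal.ofReal_le_ofReal_iff (by positivity)).1 hPB
  rw [le_div_iff₀ (by positivity)] at hreal
  exact hreal

/-- **Weighted majority vote, `δ` form.** With `m ≥ 1/(4 δ η²)` trials the product weight of the
sequences without a strict majority of good trials is at most `δ` (Blum–Micali's
`trials(ψ, φ) = 1/(4φψ²)`; for bounded-error amplification, Bennett–Bernstein–Brassard–Vazirani 1997,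
Thm. 4.13). [Kranakis 1986, Thm. 3.5; Bennett–Bernstein–Brassard–Vazirani 1997, Thm. 4.13 (proof)]
[cite: Kranakis1986, Thm. 3.5] -/
theorem sum_majority_fail_le {α : Type*} [Fintype α] (w : α → ℝ) (hw : ∀ a, 0 ≤ w a)
    (hw1 : ∑ a, w a = 1) (good : α → Prop) [DecidablePred good] {m : ℕ} {η δ : ℝ} (hη : 0 < η)
    (hδ : 0 < δ) (hm : 1 / (4 * δ * η ^ 2) ≤ m) (hgood : 1 / 2 + η ≤ ∑ a ∈ univ.filter good, w a) :
    (∑ ω ∈ univ.filter (fun ω : Fin m → α => 2 * (univ.filter fun i => good (ω i)).card ≤ m),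
        ∏ i, w (ω i)) ≤ δ := by
  have hmpos : 0 < m := by
    rcases Nat.eq_zero_or_pos m with rfl | h
    · exfalso
      have : (0 : ℝ) < 1 / (4 * δ * η ^ 2) := by positivity
      rw [Nat.cast_zero] at hm
      linarith
    · exact h
  have h := sum_majority_fail_mul_le w hw hw1 good hmpos hη hgood
  set b := ∑ ω ∈ univ.filter (fun ω : Fin m → α => 2 * (univ.filter fun i => good (ω i)).card ≤ m),
    ∏ i, w (ω i)
  have hb : 0 ≤ b := Finset.sum_nonneg fun ω _ => Finset.prod_nonneg fun i _ => hw (ω i)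
  -- `1 ≤ 4 δ η² m`, so `b ≤ b · 4 m η² · δ ≤ δ`
  have h1 : 1 ≤ 4 * δ * η ^ 2 * m := by
    rwa [div_le_iff₀ (by positivity), mul_comm] at hm
  calc b = b * 1 := (mul_one b).symm
    _ ≤ b * (4 * δ * η ^ 2 * m) := mul_le_mul_of_nonneg_left h1 hb
    _ = b * (4 * m * η ^ 2) * δ := by ring
    _ ≤ 1 * δ := mul_le_mul_of_nonneg_right h hδ.le
    _ = δ := one_mul δ

end Literature.Computability.Complexity

end
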